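import Summits.QuantumFields.YangMills.Theorems.UnitScaleTiltMinimiserStabilityRegPrPV3D
import Summits.QuantumFields.YangMills.Theorems.UnitScaleTiltProp7PV3CDEAttainment
import HarnessLib

/-!
# Route `UnitScaleTilt`, crux K1 child «MinimiserStabilityRegPr» (stmt-QuantumFields-19200) — PRINT'S ROUTE INTO THE v9 STUB `stub_existMinimal`:
# [Balaban1985Variational] Prop. 7 (ii) ⇐ (existence half of `stub_PV3C`) ∧ `stub_PV3D` (LANDED, by name) ∧ (row (E) in print's regime)

Cell `ym3-torus`, width seat `ym-ust-19200-w2` (gen 0; v9 draft `Cruxes/MinimiserStabilityRegPr/Lines/birth_v9_w2draft.lean`).  YM₃ on T³ is a ladder rung (R3), not the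
Clay problem; nothing here is a claim about the crux, d = 4 or the mass gap.

WHY.  The v9 draft replaces the four Prop-7 rows of v8 by the one statement the composition reads, `stub_existMinimal` (= clause (ii) of v7's V3: a
configuration on a minimal orbit of (6)(O₁L³B₃ε₁) over every (14)-background in the fibre of a (7)-datum).  This file records that the v8 rows still FEED it —
p. 299 of print: Prop. 6's solution `X` ((112): `nMax19 X < 3B₀L³B₃ε₁`) ↦ `e^{iX} ∈` (19) at `O₁L³B₃ε₁`, `O₁ = max{1, 3B₀}` ↦ the return to (18) (`PV3D.stub_PV3D`,
landed p589019: an axial representative `(e^{iX}U₀)^u ∈ 𝔘_k(O₂·O₁L³B₃ε₁) ∩ 𝔅_k(V)`, R2-critical) ↦ (141)–(142) IN PRINT'S REGIME (`0 < ε₁ ≤ a₆`, `PlaqSmall ε₁ V`,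
`L³B₃ε₁ ≤ e ≤ e₅`; the registered `stub_PV3E` omits these binders, w2 PROGRESS 4) ↦ a minimiser over (6)(O₂O₁L³B₃ε₁).  Neither Prop. 2 (`stub_PV3A`) nor the uniqueness
half of Prop. 6 enters.  §2 records that the regime row (E′) is itself implied by (A), (C) and the attainment schema (`Prop7PV3CDEAttainment.rowE_regime_of_A_C_att`).

WHAT IS PROVED (sorry-free, no definition).
§1 **`existMinimal_of_C_D_regE`** — at block size `L > 1`, `B₃ > 4`: the registered `stub_PV3C` text (only its `∃`-half is used) ∧ the regime row (E′) ⇒ the text of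
   `stub_existMinimal` at `(L, B₃)`; row (D) is DISCHARGED by `Summit.QuantumFields.YangMills.Theorems.PV3D.stub_PV3D`.
§2 **`regE_of_A_C_att`** — (E′) ⇐ `stub_PV3A`-text ∧ `stub_PV3C`-text ∧ `∃ a₀′ a₁′ > 0, MinSixAttainedAt L a₀′ a₁′ (L³B₃)` (bookkeeping over
   `Prop7PV3CDEAttainment.rowE_regime_of_A_C_att`).

HONEST SCOPE.  Props 5–6 (existence half: the contraction (116)–(121)) and (141)–(142) are HYPOTHESES; (D) is the landed theorem.  Count-neutral helper toward
stmt-QuantumFields-19200 (`--supports`), not a proof of any stub.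

References: T. Bałaban, CMP 102 (1985) 277–309 [Balaban1985Variational] ((6)–(7) p.278, (14) p.280, (18)–(21) pp.280–281, Prop. 6 p.295, (112) p.294, (141)–(142) p.299,
Prop. 7 p.299); CMP 99 (1985) 75–102 [Balaban1985RegularSpaces] (Prop. 7 (1.144) p.100).
-/

noncomputable section

namespace Summit.QuantumFields.YangMills.Theorems.Prop7ExistMinimalOfRows

open Literature.MathematicalPhysics.QuantumFieldTheory.Balaban1983to89
open Literature.MathematicalPhysics.QuantumFieldTheory.Balaban1983to89.T3ContinuumYM3Torus
open Literature.MathematicalPhysics.QuantumFieldTheory.Balaban1983to89.T3UnitLawDensityEML (ℰp)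
open Literature.MathematicalPhysics.QuantumFieldTheory.Balaban1983to89.T3DescentFibreTower
open Literature.MathematicalPhysics.QuantumFieldTheory.Balaban1983to89.T3ConstrainedMinimiser
open Literature.MathematicalPhysics.QuantumFieldTheory.Balaban1983to89.T3TiltDescent
open Literature.MathematicalPhysics.QuantumFieldTheory.Balaban1983to89.T3PrintedRegularMinimiser
open Literature.MathematicalPhysics.QuantumFieldTheory.Balaban1983to89.T3PrintedRegularOrbits (descTransf gaugeAct_mem_regFibrePr_iff_of_trivial)
open B11 (VarProblemX LGData Prop2Printed Prop5Printed Prop6Printed)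
open B11Prop7Assembly (Bridge ExistenceLeavesCap one_landau_of_props silent_restrictions eps2_ge_prop2 ineq122_le second_condition_auto)
open B7Prop1Explicit renaming Site → LSite
open B7Prop2Explicit (C0 c2' C0_pos c2'_pos)
open B8Eq119TwistedAxial (InAx Restr129)
open B8Thm4TorusAt (torusLam)
open B15DeterminingSets (embIter)
open B10Eq27TorusAxialLog (pull unitsField toUField)
open B8Thm2SetupTorus (pullGauge toUGauge)
open T3Thm1Carrier
open T3Thm1CarrierNative (IsCritR2 Prop7From14At)
open T3SectALandauChart
open Summit.QuantumFields.YangMills.Theorems.Prop7ChartInjectivity (sameOrbit_of_eq_law)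
open Summit.QuantumFields.YangMills.Theorems.Prop7AxialReprPrint (inj16_print_based)
open Summit.QuantumFields.YangMills.Theorems.Prop7ChartPrint (atMostOneCriticalOrbit_of_props_inj' gaugeFix_of_conditional_axialRepr' axialRepr_print_based_uniform)
open Summit.QuantumFields.YangMills.Theorems.Prop7TPrint
open NormedSpace

open scoped Matrix.Norms.L2Operator
open Summit.QuantumFields.YangMills.Theorems.Prop7SPrint
open Summit.QuantumFields.YangMills.Theorems.Prop7PV3CDELogChart (in19_expHermField_of_nMax19_lt prop6Printed_logChart_iff)
open Literature.MathematicalPhysics.QuantumFieldTheory.Balaban1983to89.T3ExistSplit (MinSixAttainedAt)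

variable {L : ℕ}

/-! ## §1 `stub_existMinimal` from the existence half of (C), the landed (D), and (E) in print's regime -/

/-- **PROP. 7 (ii) FROM PROP. 6's SOLUTION, THE RETURN TO (18) AND (142) IN PRINT'S REGIME** (p. 299): `a₁′ = min{a₄/(2B₀L³B₃), e₅/(O₂O₁L³B₃), c/(O₁L³B₃), a₆}`,
`O₁ := O₂·max{1, 3B₀}` with `O₂, c` the constants of the landed row (D). [cite: Balaban1985Variational, Prop. 7 p.299, (112) p.294, (141)-(142) p.299] -/
theorem existMinimal_of_C_D_regE (hL : 1 < L) {B₃ : ℝ} (hB₃ : 4 < B₃)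
    (hC : ∃ B₀ a₄ : ℝ, 0 < B₀ ∧ 0 < a₄ ∧ ∀ (i : Idx L) (ε₁ ε₄ : ℝ), 0 < ε₁ → ε₄ ≤ a₄ → 2 * B₀ * (L : ℝ) ^ 3 * B₃ * ε₁ ≤ ε₄ →
        ∀ (V : GaugeField (i.1.1.P i.1.2.1) 0 (Matrix.specialUnitaryGroup (Fin 2) ℂ))
          (U₀ : GaugeField (i.1.1.P i.1.2.2) 0 (Matrix.specialUnitaryGroup (Fin 2) ℂ)),
          RegPr i.1.1 i.1.2.1 i.1.2.2 ((L : ℝ) ^ 3 * B₃ * ε₁) U₀ → CloseAvg i.1.1 i.1.2.1 i.1.2.2 i.2.2.le ((L : ℝ) ^ 3 * ε₁) V U₀ →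
          ∃ X : PBond (i.1.1.P i.1.2.2) 0 → Matrix (Fin 2) (Fin 2) ℂ,
            nMax19 i.1.1 i.1.2.1 i.1.2.2 U₀ X < ε₄ ∧
            ((∀ b : PBond (i.1.1.P i.1.2.2) 0, (X b).IsHermitian ∧ Matrix.trace (X b) = 0) ∧ AvgCondPrint i.1.1 i.1.2.1 i.1.2.2 i.2.2.le V U₀ X ∧
              IsLandauPrint i.1.1 i.1.2.1 i.1.2.2 U₀ X ∧ CritLPrint i.1.1 i.1.2.1 i.1.2.2 i.2.2.le V U₀ (expHermField X)) ∧
            nMax19 i.1.1 i.1.2.1 i.1.2.2 U₀ X < 3 * B₀ * (L : ℝ) ^ 3 * B₃ * ε₁ ∧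
            ∀ X' : PBond (i.1.1.P i.1.2.2) 0 → Matrix (Fin 2) (Fin 2) ℂ, nMax19 i.1.1 i.1.2.1 i.1.2.2 U₀ X' < ε₄ →
              ((∀ b : PBond (i.1.1.P i.1.2.2) 0, (X' b).IsHermitian ∧ Matrix.trace (X' b) = 0) ∧ AvgCondPrint i.1.1 i.1.2.1 i.1.2.2 i.2.2.le V U₀ X' ∧
                IsLandauPrint i.1.1 i.1.2.1 i.1.2.2 U₀ X' ∧ CritLPrint i.1.1 i.1.2.1 i.1.2.2 i.2.2.le V U₀ (expHermField X')) → X' = X)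
    (hE : ∃ e₅ a₆ : ℝ, 0 < e₅ ∧ 0 < a₆ ∧ ∀ (i : Idx L) (e ε₁ : ℝ) (V : GaugeField (i.1.1.P i.1.2.1) 0 (Matrix.specialUnitaryGroup (Fin 2) ℂ))
      (U₀ U₁ : GaugeField (i.1.1.P i.1.2.2) 0 (Matrix.specialUnitaryGroup (Fin 2) ℂ)) (u : GaugeTransf (i.1.1.P i.1.2.2) 0 (Matrix.specialUnitaryGroup (Fin 2) ℂ)),
      0 < ε₁ → ε₁ ≤ a₆ → PlaqSmall ε₁ V → (L : ℝ) ^ 3 * B₃ * ε₁ ≤ e → e ≤ e₅ →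
      RegPr i.1.1 i.1.2.1 i.1.2.2 ((L : ℝ) ^ 3 * B₃ * ε₁) U₀ → CloseAvg i.1.1 i.1.2.1 i.1.2.2 i.2.2.le ((L : ℝ) ^ 3 * ε₁) V U₀ →
      CritLPrint i.1.1 i.1.2.1 i.1.2.2 i.2.2.le V U₀ U₁ → RestrictedPrint i.1.1 i.1.2.1 i.1.2.2 U₀ u →
      RegPr i.1.1 i.1.2.1 i.1.2.2 e (GaugeField.gaugeAct u (emb15 U₀ U₁)) →
      GaugeField.gaugeAct u (emb15 U₀ U₁) ∈ fibre i.1.1 ℰp i.1.2.1 i.1.2.2 i.2.2.le V →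
      IsCritR2 i.1.1 i.1.2.1 i.1.2.2 i.2.2.le V (GaugeField.gaugeAct u (emb15 U₀ U₁)) →
        GaugeField.gaugeAct u (emb15 U₀ U₁) ∈ regFibrePr i.1.1 i.1.2.1 i.1.2.2 i.2.2.le e V ∧
        IsMinOn (fun W : GaugeField (i.1.1.P i.1.2.2) 0 (Matrix.specialUnitaryGroup (Fin 2) ℂ) => wilsonAction4 W)
          (regFibrePr i.1.1 i.1.2.1 i.1.2.2 i.2.2.le e V) (GaugeField.gaugeAct u (emb15 U₀ U₁))) :
    ∃ a₁' O₁ : ℝ, 0 < a₁' ∧ 1 ≤ O₁ ∧ ∀ (i : Idx L) (ε₁ : ℝ), 0 < ε₁ → ε₁ ≤ a₁' → ∀ V : (famX L i).Bdry, (famX L i).Reg7 ε₁ V →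
      ∀ U₀ : (famX L i).Cfg, (famX L i).InU ((L : ℝ) ^ 3 * B₃ * ε₁) U₀ → (famX L i).InB V U₀ →
        ∃ U : (famX L i).Cfg, (famX L i).OnMinimalOrbit (O₁ * (L : ℝ) ^ 3 * B₃ * ε₁) V U := by
  have hL1 : (1 : ℝ) ≤ (L : ℝ) := by exact_mod_cast hL.le
  have hC₁pos : (0 : ℝ) < (L : ℝ) ^ 3 := by positivity
  have hB₃0 : 0 < B₃ := by linarith
  obtain ⟨B₀, a₄, hB₀, ha₄, HC⟩ := hC
  obtain ⟨O₂, c, hO₂, hc, HD⟩ := Summit.QuantumFields.YangMills.Theorems.PV3D.stub_PV3D L hL B₃ hB₃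
  obtain ⟨e₅, a₆, he₅, ha₆, HE⟩ := hE
  set O₁ : ℝ := max 1 (3 * B₀) with hO₁
  have hO₁1 : 1 ≤ O₁ := le_max_left _ _
  have hO₁3 : 3 * B₀ ≤ O₁ := le_max_right _ _
  have hO₁0 : 0 < O₁ := lt_of_lt_of_le one_pos hO₁1
  have hK : 0 < 2 * B₀ * (L : ℝ) ^ 3 * B₃ := by positivity
  have hK' : 0 < O₂ * O₁ * (L : ℝ) ^ 3 * B₃ := by positivity
  have hK'' : 0 < O₁ * (L : ℝ) ^ 3 * B₃ := by positivity
  set a₁' : ℝ := min (min (min (a₄ / (2 * B₀ * (L : ℝ) ^ 3 * B₃)) (e₅ / (O₂ * O₁ * (L : ℝ) ^ 3 * B₃))) (c / (O₁ * (L : ℝ) ^ 3 * B₃))) a₆ with ha₁'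
  have ha₁'0 : 0 < a₁' := lt_min (lt_min (lt_min (div_pos ha₄ hK) (div_pos he₅ hK')) (div_pos hc hK'')) ha₆
  refine ⟨a₁', O₂ * O₁, ha₁'0, one_le_mul_of_one_le_of_one_le hO₂ hO₁1, ?_⟩
  intro i ε₁ hε₁ hε₁a V hV U₀ hU₀ hB
  obtain ⟨⟨F, n, K⟩, hF, hnK⟩ := i
  obtain ⟨hreg, hclose⟩ := sat14T3_of_mem_fibre (h := hnK.le) (mul_pos hC₁pos hε₁) hU₀ hB
  have h2B : 2 * B₀ * (L : ℝ) ^ 3 * B₃ * ε₁ ≤ a₄ := by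
    have := (le_div_iff₀ hK).1 (hε₁a.trans ((min_le_left _ _).trans ((min_le_left _ _).trans (min_le_left _ _)))); linarith
  have hcap : O₂ * (O₁ * (L : ℝ) ^ 3 * B₃ * ε₁) ≤ e₅ := by
    have := (le_div_iff₀ hK').1 (hε₁a.trans ((min_le_left _ _).trans ((min_le_left _ _).trans (min_le_right _ _)))); linarith
  have hεc : O₁ * (L : ℝ) ^ 3 * B₃ * ε₁ ≤ c := by
    have := (le_div_iff₀ hK'').1 (hε₁a.trans ((min_le_left _ _).trans (min_le_right _ _))); linarith
  have hε₁a₆ : ε₁ ≤ a₆ := hε₁a.trans (min_le_right _ _)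
  -- Prop. 6's solution at ε₄ = a₄, with (112)
  obtain ⟨X, -, ⟨hX, h20, h21, hcrit⟩, hX3, -⟩ := HC ⟨(F, n, K), hF, hnK⟩ ε₁ a₄ hε₁ le_rfl h2B V U₀ hreg hclose
  -- (112) ⇒ (19) at O₁L³B₃ε₁
  have h19 : In19 F n K (O₁ * (L : ℝ) ^ 3 * B₃ * ε₁) U₀ (expHermField X) X := by
    have hmono : 3 * B₀ * (L : ℝ) ^ 3 * B₃ * ε₁ ≤ O₁ * (L : ℝ) ^ 3 * B₃ * ε₁ := by
      have : 0 ≤ (L : ℝ) ^ 3 * B₃ * ε₁ := by positivity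
      nlinarith
    exact in19_expHermField_of_nMax19_lt hX (lt_of_lt_of_le hX3 hmono)
  have hreg₂ : (L : ℝ) ^ 3 * B₃ * ε₁ ≤ O₁ * (L : ℝ) ^ 3 * B₃ * ε₁ := by
    have : 0 ≤ (L : ℝ) ^ 3 * B₃ * ε₁ := by positivity
    nlinarith
  -- the return to (18) (row D, landed)
  obtain ⟨u, hu, hRegW, hWfib, hWcrit⟩ :=
    HD ⟨(F, n, K), hF, hnK⟩ ε₁ (O₁ * (L : ℝ) ^ 3 * B₃ * ε₁) V U₀ (expHermField X) X hreg₂ hεc hreg hclose h19 h20 h21 hcrit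
  -- (142) in print's regime
  have hlow : (L : ℝ) ^ 3 * B₃ * ε₁ ≤ O₂ * (O₁ * (L : ℝ) ^ 3 * B₃ * ε₁) := by
    have : 0 ≤ O₁ * (L : ℝ) ^ 3 * B₃ * ε₁ := by positivity
    nlinarith
  obtain ⟨hWmem, hWmin⟩ := HE ⟨(F, n, K), hF, hnK⟩ (O₂ * (O₁ * (L : ℝ) ^ 3 * B₃ * ε₁)) ε₁ V U₀ (expHermField X) u hε₁ hε₁a₆ hV hlow hcap hreg hclose
    hcrit hu hRegW hWfib hWcrit
  refine ⟨GaugeField.gaugeAct u (emb15 U₀ (expHermField X)), (onMinimalOrbit_iff _ V _).mpr ?_⟩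
  have hO : O₂ * O₁ * (L : ℝ) ^ 3 * B₃ * ε₁ = O₂ * (O₁ * (L : ℝ) ^ 3 * B₃ * ε₁) := by ring
  rw [hO]
  exact ⟨hWmem, hWmin⟩

/-! ## §2 The regime row (E′) from (A), (C) and the attainment schema -/

/-- **(E′) ⇐ (A) ∧ (C) ∧ ATTAINMENT** (bookkeeping over `Prop7PV3CDEAttainment.rowE_regime_of_A_C_att` with `W := (U₁U₀)^u`; the hypotheses `CritLPrint`,
`RestrictedPrint` of (E′) are idle). [cite: Balaban1985Variational, (141)-(142) p.299, Thm 1 (8) p.279] -/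
theorem regE_of_A_C_att (hL : 1 < L) (T : ResidFam L) {B₃ : ℝ} (hB₃ : 1 ≤ B₃)
    (hA : ∃ B₁ c₁ : ℝ, 0 < B₁ ∧ 0 < c₁ ∧ Prop2Printed B₁ B₃ ((L : ℝ) ^ 3) c₁ (famLG3 L (sPrint L T)))
    (hC : ∃ B₀ a₄ : ℝ, 0 < B₀ ∧ 0 < a₄ ∧ ∀ (i : Idx L) (ε₁ ε₄ : ℝ), 0 < ε₁ → ε₄ ≤ a₄ → 2 * B₀ * (L : ℝ) ^ 3 * B₃ * ε₁ ≤ ε₄ →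
        ∀ (V : GaugeField (i.1.1.P i.1.2.1) 0 (Matrix.specialUnitaryGroup (Fin 2) ℂ))
          (U₀ : GaugeField (i.1.1.P i.1.2.2) 0 (Matrix.specialUnitaryGroup (Fin 2) ℂ)),
          RegPr i.1.1 i.1.2.1 i.1.2.2 ((L : ℝ) ^ 3 * B₃ * ε₁) U₀ → CloseAvg i.1.1 i.1.2.1 i.1.2.2 i.2.2.le ((L : ℝ) ^ 3 * ε₁) V U₀ →
          ∃ X : PBond (i.1.1.P i.1.2.2) 0 → Matrix (Fin 2) (Fin 2) ℂ,
            nMax19 i.1.1 i.1.2.1 i.1.2.2 U₀ X < ε₄ ∧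
            ((∀ b : PBond (i.1.1.P i.1.2.2) 0, (X b).IsHermitian ∧ Matrix.trace (X b) = 0) ∧ AvgCondPrint i.1.1 i.1.2.1 i.1.2.2 i.2.2.le V U₀ X ∧
              IsLandauPrint i.1.1 i.1.2.1 i.1.2.2 U₀ X ∧ CritLPrint i.1.1 i.1.2.1 i.1.2.2 i.2.2.le V U₀ (expHermField X)) ∧
            nMax19 i.1.1 i.1.2.1 i.1.2.2 U₀ X < 3 * B₀ * (L : ℝ) ^ 3 * B₃ * ε₁ ∧
            ∀ X' : PBond (i.1.1.P i.1.2.2) 0 → Matrix (Fin 2) (Fin 2) ℂ, nMax19 i.1.1 i.1.2.1 i.1.2.2 U₀ X' < ε₄ →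
              ((∀ b : PBond (i.1.1.P i.1.2.2) 0, (X' b).IsHermitian ∧ Matrix.trace (X' b) = 0) ∧ AvgCondPrint i.1.1 i.1.2.1 i.1.2.2 i.2.2.le V U₀ X' ∧
                IsLandauPrint i.1.1 i.1.2.1 i.1.2.2 U₀ X' ∧ CritLPrint i.1.1 i.1.2.1 i.1.2.2 i.2.2.le V U₀ (expHermField X')) → X' = X)
    (hATT : ∃ a₀' a₁' : ℝ, 0 < a₀' ∧ 0 < a₁' ∧ MinSixAttainedAt L a₀' a₁' ((L : ℝ) ^ 3 * B₃)) :
    ∃ e₅ a₆ : ℝ, 0 < e₅ ∧ 0 < a₆ ∧ ∀ (i : Idx L) (e ε₁ : ℝ) (V : GaugeField (i.1.1.P i.1.2.1) 0 (Matrix.specialUnitaryGroup (Fin 2) ℂ))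
      (U₀ U₁ : GaugeField (i.1.1.P i.1.2.2) 0 (Matrix.specialUnitaryGroup (Fin 2) ℂ)) (u : GaugeTransf (i.1.1.P i.1.2.2) 0 (Matrix.specialUnitaryGroup (Fin 2) ℂ)),
      0 < ε₁ → ε₁ ≤ a₆ → PlaqSmall ε₁ V → (L : ℝ) ^ 3 * B₃ * ε₁ ≤ e → e ≤ e₅ →
      RegPr i.1.1 i.1.2.1 i.1.2.2 ((L : ℝ) ^ 3 * B₃ * ε₁) U₀ → CloseAvg i.1.1 i.1.2.1 i.1.2.2 i.2.2.le ((L : ℝ) ^ 3 * ε₁) V U₀ →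
      CritLPrint i.1.1 i.1.2.1 i.1.2.2 i.2.2.le V U₀ U₁ → RestrictedPrint i.1.1 i.1.2.1 i.1.2.2 U₀ u →
      RegPr i.1.1 i.1.2.1 i.1.2.2 e (GaugeField.gaugeAct u (emb15 U₀ U₁)) →
      GaugeField.gaugeAct u (emb15 U₀ U₁) ∈ fibre i.1.1 ℰp i.1.2.1 i.1.2.2 i.2.2.le V →
      IsCritR2 i.1.1 i.1.2.1 i.1.2.2 i.2.2.le V (GaugeField.gaugeAct u (emb15 U₀ U₁)) →
        GaugeField.gaugeAct u (emb15 U₀ U₁) ∈ regFibrePr i.1.1 i.1.2.1 i.1.2.2 i.2.2.le e V ∧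
        IsMinOn (fun W : GaugeField (i.1.1.P i.1.2.2) 0 (Matrix.specialUnitaryGroup (Fin 2) ℂ) => wilsonAction4 W)
          (regFibrePr i.1.1 i.1.2.1 i.1.2.2 i.2.2.le e V) (GaugeField.gaugeAct u (emb15 U₀ U₁)) := by
  obtain ⟨B₀, a₄, hB₀, ha₄, HC⟩ := hC
  have hC' : ∃ B₀ : ℝ, 0 < B₀ ∧ Prop6Printed B₀ B₃ ((L : ℝ) ^ 3) (famLG3 L (tPrintFam (sPrint L T))) :=
    ⟨B₀, hB₀, (prop6Printed_logChart_iff (sPrint L T)).2 ⟨a₄, ha₄, HC⟩⟩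
  have hA' : ∃ B₁ c₁ : ℝ, 0 < B₁ ∧ 0 < c₁ ∧ Prop2Printed B₁ B₃ ((L : ℝ) ^ 3) c₁ (famLG3 L (tPrintFam (sPrint L T))) := by
    obtain ⟨B₁, c₁, hB₁, hc₁, h2⟩ := hA
    exact ⟨B₁, c₁, hB₁, hc₁, (Summit.QuantumFields.YangMills.Theorems.Prop7PV3CDEAtSPrint.prop2Printed_tPrintFam_iff (sPrint L T)).2 h2⟩
  obtain ⟨e₅, a₁'', he₅, ha₁'', H⟩ :=
    Summit.QuantumFields.YangMills.Theorems.Prop7PV3CDEAttainment.rowE_regime_of_A_C_att hL (sPrint L T) hB₃ (hSax_sPrint T) (hSre_sPrint T) hA' hC' hATT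
  refine ⟨e₅, a₁'', he₅, ha₁'', ?_⟩
  intro i e ε₁ V U₀ U₁ u hε₁ hε₁a hV hreg hecap hRU₀ hclose _ _ hRegW hWfib hWcrit
  obtain ⟨⟨F, n, K⟩, hF, hnK⟩ := i
  have hWmem : GaugeField.gaugeAct u (emb15 U₀ U₁) ∈ regFibrePr F n K hnK.le e V := (mem_regFibrePr_iff F).mpr ⟨hWfib, hRegW⟩
  exact ⟨hWmem, H ⟨(F, n, K), hF, hnK⟩ e ε₁ V U₀ _ hε₁ hε₁a hV hreg hecap hRU₀ hclose hWmem hWcrit⟩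

end Summit.QuantumFields.YangMills.Theorems.Prop7ExistMinimalOfRows

end
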